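import Summits.QuantumFields.YangMills.Theorems.UV3PinnedStepOfAnchored
import Summits.QuantumFields.YangMills.Theorems.UV3PinnedStepProfileReduction
import HarnessLib

/-!
# S-STEP v3 (R-a′: Bałaban-shaped rate at a free profile per `(F, γ)`) FROM THE PURE-PIN ANCHORED PAIR AT THE FLOOR PROFILE — the two bridges composed:
# profile reduction (✓`UV3PinnedStepProfileReduction`) then envelope exchange (✓`UV3PinnedStepOfAnchored`)

Cell `ym3-torus` (YM ladder rung R3 = continuum `SU(2)` Yang–Mills on the three-torus — a RUNG, NOT d = 4, NOT infinite volume, NOT a mass gap, NOT Clay).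
Twin-width seat `ym-ust-19936-w8` (gen 11); `--supports stmt-QuantumFields-19936 --as helper`, count-neutral, definition-free, default heartbeats.
Crux `UnitScaleTilt.HistoryTailL` (stmt-QuantumFields-19936); row R-19936-S = `stub_pinnedStep` of `Cruxes/HistoryTailL/Lines/pinned_stability.lean` v2′.

THE POINT (px8 g11 ‼ (F2) PROFILE COUPLING and its repair (R-a), `LOCATE-PINNED41-RESTRICTION-px8g11.md` §2).  The registered v2′ S-step carries the rate
`exp(−c·p_{b₀,p₀}(g_{K−j})²)` in the EVENT's profile for every `(b₀, p₀)` above the floors; a one-profile (α) socket delivers the pinned (41) at ONE profile, and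
`p_{b₀,p₀}∕p_{floors} → ∞` down the heights — so the event-profile rate is not derivable from the typed inputs ((67)∕(70)–(71) are threshold-generic in print, not in
the socket).  v3 (R-a′) lets the prover choose the rate profile `(b, p)` per `(F, γ)`.  THIS FILE types the v3 S-step from ONE anchored row per `(F, γ)` at ONE profile:
* ★★★ `stub_pinnedStepV3_of_purePinAnchoredPair` — from `hA : ∀ L, ∃ (b₁', p₁') (0 < b₁', 1 ≤ p₁'), ∀ m > 0, ∃ γ₁ ∈ (0, 1], ∀ F γ (F.L = L, 0 < γ ≤ γ₁),
  ∃ E Cu Cl c A, 0 < c ∧ (∀ K, e^{−E K − Cl} ≤ ∫ρ_K) ∧ (∀ K j ⟨guards⟩ a, ρ^{Pin_{b₁'p₁'}(K,j,a)}_K ≤ e^{−E K + Cu}·β_{K−j}^A·e^{−c·p_{b₁',p₁'}(g_{K−j})²}` a.e.)` —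
  the PURE-PIN anchored pair at the floor profile — conclude the v3 S-step text (R-a′, ideator `ym-r3-idea-2` g17 2026-08-29T22:19:59Z, ★★OWNER WORD 55: the constants
  line `∃ (b p Cu c : ℝ) (A : ℕ), 0 < b ∧ 1 ≤ p ∧ 0 < c ∧ …` with the Bałaban-shaped rate `e^{−c·p_{b,p}(g_{K−j})²}` at a FREE profile chosen per `(F, γ)`; event, conditioner,
  guards, `M`-envelope as in v2′): witnesses `(b, p) :=` the floors, by ✓`anchoredStep_of_purePin_floor` (event ⊆ pure pin at the floors, `ρ^S_K` monotone in `S`) and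
  ✓`ae_resDensity_le_envelope_of_anchored` (`M ≥ ∫ρ_K ≥ e^{−E−Cl}`).
* ★★ `stub_pinnedStepV3_of_anchoredPair` — the direct one-letter twin of ✓`UV3PinnedStepOfAnchored.stub_pinnedStep_of_anchoredPair` for the v3 letter: the anchored pair per
  `(F, γ)` with the event at `(b₀, p₀)` and the rate at a free profile `(b, p)` (`0 < b`, `1 ≤ p`).
The conclusions are the v3 CANDIDATE letter (to be matched byte for byte against the registered v3 when `ym-r3-idea-2` g17 registers it; this file changes and proposes nothing in
the registry).

HONEST SCOPE.  Bookkeeping; the pure-pin anchored (41) at one profile is R-19936-S's organ and stays DISPLAYED; nothing of `stub_pinnedStep` (either letter), `hP`,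
`HistoryTailL` (19936) or the rung is proved here.  Sorry-free, axioms standard.

References: T. Bałaban, *Ultraviolet stability of three-dimensional lattice pure gauge field theories*, Commun. Math. Phys. **102** (1985) 255–275
[Balaban1985UV3] ((5)–(7) pp.256–257, (41) p.266, (47) p.267, (67), (70)–(71) p.273).
-/

set_option autoImplicit false

noncomputable section

namespace Summit.QuantumFields.YangMills.Theorems.UV3PinnedStepV3OfAnchored

open MeasureTheory
open Literature.MathematicalPhysics.QuantumFieldTheory.Balaban1983to89
open Literature.MathematicalPhysics.QuantumFieldTheory.Balaban1983to89.T3ContinuumYM3Torus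
open Literature.MathematicalPhysics.QuantumFieldTheory.Balaban1983to89.T3UnitLawDensityEML (ℰp emlDensity)
open Literature.MathematicalPhysics.QuantumFieldTheory.Balaban1983to89.T3UnitScaleTilt (θBal)
open Literature.MathematicalPhysics.QuantumFieldTheory.Balaban1983to89.T3RestrictedUnitDensity (resDensity)
open Summit.QuantumFields.YangMills.Theorems.UV3PinnedStepOfAnchored (ae_resDensity_le_envelope_of_anchored)
open Summit.QuantumFields.YangMills.Theorems.UV3PinnedStepProfileReduction (anchoredStep_of_purePin_floor)

/-- ★★★ **S-STEP v3 (R-a′ letter) FROM THE PURE-PIN ANCHORED PAIR AT THE FLOOR PROFILE** — witnesses `(b, p) :=` the floors `(b₁', p₁')` (`0 < b₁'`, `1 ≤ p₁'` supplied by the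
row); see the module docstring.
[cite: Balaban1985UV3, (5) p.256, (7) p.257, (41) p.266, (47) p.267, (70)–(71) p.273] -/
theorem stub_pinnedStepV3_of_purePinAnchoredPair
    (hA : ∀ (L : ℕ), ∃ (b₁' p₁' : ℝ), 0 < b₁' ∧ 1 ≤ p₁' ∧ ∀ (m : ℕ), 0 < m →
      ∃ γ₁ : ℝ, 0 < γ₁ ∧ γ₁ ≤ 1 ∧ ∀ (F : T3Family) (γ : ℝ), F.L = L → 0 < γ → γ ≤ γ₁ →
        ∃ (E : ℕ → ℝ) (Cu Cl c : ℝ) (A : ℕ), 0 < c ∧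
          (∀ K : ℕ, Real.exp (-E K - Cl) ≤ ∫ V, emlDensity F γ K K V ∂fieldMeasure (F.P K) K (Matrix.specialUnitaryGroup (Fin 2) ℂ)) ∧
          ∀ (K j : ℕ), 1 ≤ j → j + 2 ≤ K → j + (K - 1) / m ≤ K → ∀ (a : Plaq (F.P K) j),
            ∀ᵐ V ∂(fieldMeasure (F.P K) K (Matrix.specialUnitaryGroup (Fin 2) ℂ)),
              resDensity F γ K
                {U : GaugeField (F.P K) 0 (Matrix.specialUnitaryGroup (Fin 2) ℂ) |
                  θBal F.L γ b₁' p₁' (K - j) ≤ GaugeGroup.dist1 (GaugeField.plaqHol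
                    (Averaging.iter (fun i' => BlockAveraging.blockAvg (P := F.P K) (j := i') ℰp) j U) a)}
                K V ≤
              Real.exp (-E K + Cu) *
                ((F.scheme ℰp γ).β (K - j) ^ A * Real.exp (-(c * B10.pFun b₁' p₁' (Real.sqrt (γ * ((F.L : ℝ)⁻¹) ^ (K - j))) ^ 2)))) :
    ∀ (L : ℕ), ∃ (b₁' p₁' : ℝ), ∀ (b₀ p₀ : ℝ), b₁' ≤ b₀ → p₁' ≤ p₀ → 0 < b₀ → 2 < p₀ → ∀ (m : ℕ), 0 < m →
      ∃ γ₁ : ℝ, 0 < γ₁ ∧ γ₁ ≤ 1 ∧ ∀ (F : T3Family) (γ : ℝ), F.L = L → 0 < γ → γ ≤ γ₁ →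
        ∃ (b p Cu c : ℝ) (A : ℕ), 0 < b ∧ 1 ≤ p ∧ 0 < c ∧ ∀ (K j : ℕ), 1 ≤ j → j + 2 ≤ K → j + (K - 1) / m ≤ K → ∀ (a : Plaq (F.P K) j) (M : ℝ),
          (∀ᵐ V ∂(fieldMeasure (F.P K) K (Matrix.specialUnitaryGroup (Fin 2) ℂ)), emlDensity F γ K K V ≤ M) →
          ∀ᵐ V ∂(fieldMeasure (F.P K) K (Matrix.specialUnitaryGroup (Fin 2) ℂ)),
            resDensity F γ K
              ({U : GaugeField (F.P K) 0 (Matrix.specialUnitaryGroup (Fin 2) ℂ) |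
                  θBal F.L γ b₀ p₀ (K - j) ≤ GaugeGroup.dist1 (GaugeField.plaqHol
                    (Averaging.iter (fun i' => BlockAveraging.blockAvg (P := F.P K) (j := i') ℰp) j U) a)} ∩
                {U : GaugeField (F.P K) 0 (Matrix.specialUnitaryGroup (Fin 2) ℂ) | ∀ i, i < j →
                  PlaqSmall (θBal F.L γ b₀ p₀ (K - i))
                    (Averaging.iter (fun i' => BlockAveraging.blockAvg (P := F.P K) (j := i') ℰp) i U)})
              K V ≤
            M * Real.exp Cu *
              ((F.scheme ℰp γ).β (K - j) ^ A * Real.exp (-(c * B10.pFun b p (Real.sqrt (γ * ((F.L : ℝ)⁻¹) ^ (K - j))) ^ 2))) := by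
  intro L
  obtain ⟨b₁', p₁', hb₁', hp₁', HA⟩ := hA L
  refine ⟨b₁', p₁', fun b₀ p₀ hbb hpp _ _ m hm => ?_⟩
  obtain ⟨γ₁, hγ₁, hγ₁1, HF⟩ := HA m hm
  refine ⟨γ₁, hγ₁, hγ₁1, fun F γ hFL hγ hγle => ?_⟩
  obtain ⟨E, Cu, Cl, c, A, hc, hlow, hpin⟩ := HF F γ hFL hγ hγle
  obtain ⟨Cu', c', A', hc', hstep⟩ :=
    anchoredStep_of_purePin_floor F hγ.le (hγle.trans hγ₁1) hb₁'.le E m ⟨Cu, c, A, hc, hpin⟩ hbb hpp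
  refine ⟨b₁', p₁', Cu' + Cl, c', A', hb₁', hp₁', hc', fun K j hj1 hjK hjm a M hM => ?_⟩
  have hw : 0 ≤ (F.scheme ℰp γ).β (K - j) ^ A' *
      Real.exp (-(c' * B10.pFun b₁' p₁' (Real.sqrt (γ * ((F.L : ℝ)⁻¹) ^ (K - j))) ^ 2)) :=
    mul_nonneg (pow_nonneg (F.scheme_β_nonneg ℰp hγ.le (K - j)) A') (Real.exp_nonneg _)
  exact ae_resDensity_le_envelope_of_anchored F hγ.le K _ hw (hstep K j hj1 hjK hjm a) (hlow K) M hM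

/-- ★★ **S-STEP v3 (R-a′ letter) FROM THE ANCHORED PAIR, DIRECT TWIN** of ✓`UV3PinnedStepOfAnchored.stub_pinnedStep_of_anchoredPair`: per `(F, γ)` the row supplies a rate profile
`(b, p)` with `0 < b`, `1 ≤ p`, an anchor `E`, the (47)-half and the anchored pinned (41) for `hP`'s event at every `(b₀, p₀)` above the floors with the rate at `(b, p)`; the
envelope exchange ✓`ae_resDensity_le_envelope_of_anchored` gives the v3 text (`Cu ↦ Cu + Cl`). [cite: Balaban1985UV3, (5) p.256, (7) p.257, (41) p.266, (47) p.267, (70)–(71) p.273] -/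
theorem stub_pinnedStepV3_of_anchoredPair
    (hA : ∀ (L : ℕ), ∃ (b₁' p₁' : ℝ), ∀ (b₀ p₀ : ℝ), b₁' ≤ b₀ → p₁' ≤ p₀ → 0 < b₀ → 2 < p₀ → ∀ (m : ℕ), 0 < m →
      ∃ γ₁ : ℝ, 0 < γ₁ ∧ γ₁ ≤ 1 ∧ ∀ (F : T3Family) (γ : ℝ), F.L = L → 0 < γ → γ ≤ γ₁ →
        ∃ (b p : ℝ) (E : ℕ → ℝ) (Cu Cl c : ℝ) (A : ℕ), 0 < b ∧ 1 ≤ p ∧ 0 < c ∧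
          (∀ K : ℕ, Real.exp (-E K - Cl) ≤ ∫ V, emlDensity F γ K K V ∂fieldMeasure (F.P K) K (Matrix.specialUnitaryGroup (Fin 2) ℂ)) ∧
          ∀ (K j : ℕ), 1 ≤ j → j + 2 ≤ K → j + (K - 1) / m ≤ K → ∀ (a : Plaq (F.P K) j),
            ∀ᵐ V ∂(fieldMeasure (F.P K) K (Matrix.specialUnitaryGroup (Fin 2) ℂ)),
              resDensity F γ K
                ({U : GaugeField (F.P K) 0 (Matrix.specialUnitaryGroup (Fin 2) ℂ) |
                    θBal F.L γ b₀ p₀ (K - j) ≤ GaugeGroup.dist1 (GaugeField.plaqHol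
                      (Averaging.iter (fun i' => BlockAveraging.blockAvg (P := F.P K) (j := i') ℰp) j U) a)} ∩
                  {U : GaugeField (F.P K) 0 (Matrix.specialUnitaryGroup (Fin 2) ℂ) | ∀ i, i < j →
                    PlaqSmall (θBal F.L γ b₀ p₀ (K - i))
                      (Averaging.iter (fun i' => BlockAveraging.blockAvg (P := F.P K) (j := i') ℰp) i U)})
                K V ≤
              Real.exp (-E K + Cu) *
                ((F.scheme ℰp γ).β (K - j) ^ A * Real.exp (-(c * B10.pFun b p (Real.sqrt (γ * ((F.L : ℝ)⁻¹) ^ (K - j))) ^ 2)))) :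
    ∀ (L : ℕ), ∃ (b₁' p₁' : ℝ), ∀ (b₀ p₀ : ℝ), b₁' ≤ b₀ → p₁' ≤ p₀ → 0 < b₀ → 2 < p₀ → ∀ (m : ℕ), 0 < m →
      ∃ γ₁ : ℝ, 0 < γ₁ ∧ γ₁ ≤ 1 ∧ ∀ (F : T3Family) (γ : ℝ), F.L = L → 0 < γ → γ ≤ γ₁ →
        ∃ (b p Cu c : ℝ) (A : ℕ), 0 < b ∧ 1 ≤ p ∧ 0 < c ∧ ∀ (K j : ℕ), 1 ≤ j → j + 2 ≤ K → j + (K - 1) / m ≤ K → ∀ (a : Plaq (F.P K) j) (M : ℝ),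
          (∀ᵐ V ∂(fieldMeasure (F.P K) K (Matrix.specialUnitaryGroup (Fin 2) ℂ)), emlDensity F γ K K V ≤ M) →
          ∀ᵐ V ∂(fieldMeasure (F.P K) K (Matrix.specialUnitaryGroup (Fin 2) ℂ)),
            resDensity F γ K
              ({U : GaugeField (F.P K) 0 (Matrix.specialUnitaryGroup (Fin 2) ℂ) |
                  θBal F.L γ b₀ p₀ (K - j) ≤ GaugeGroup.dist1 (GaugeField.plaqHol
                    (Averaging.iter (fun i' => BlockAveraging.blockAvg (P := F.P K) (j := i') ℰp) j U) a)} ∩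
                {U : GaugeField (F.P K) 0 (Matrix.specialUnitaryGroup (Fin 2) ℂ) | ∀ i, i < j →
                  PlaqSmall (θBal F.L γ b₀ p₀ (K - i))
                    (Averaging.iter (fun i' => BlockAveraging.blockAvg (P := F.P K) (j := i') ℰp) i U)})
              K V ≤
            M * Real.exp Cu *
              ((F.scheme ℰp γ).β (K - j) ^ A * Real.exp (-(c * B10.pFun b p (Real.sqrt (γ * ((F.L : ℝ)⁻¹) ^ (K - j))) ^ 2))) := by
  intro L
  obtain ⟨b₁', p₁', HA⟩ := hA L
  refine ⟨b₁', p₁', fun b₀ p₀ hbb hpp hb₀ hp₀ m hm => ?_⟩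
  obtain ⟨γ₁, hγ₁, hγ₁1, HF⟩ := HA b₀ p₀ hbb hpp hb₀ hp₀ m hm
  refine ⟨γ₁, hγ₁, hγ₁1, fun F γ hFL hγ hγle => ?_⟩
  obtain ⟨b, p, E, Cu, Cl, c, A, hb, hp, hc, hlow, hstep⟩ := HF F γ hFL hγ hγle
  refine ⟨b, p, Cu + Cl, c, A, hb, hp, hc, fun K j hj1 hjK hjm a M hM => ?_⟩
  have hw : 0 ≤ (F.scheme ℰp γ).β (K - j) ^ A *
      Real.exp (-(c * B10.pFun b p (Real.sqrt (γ * ((F.L : ℝ)⁻¹) ^ (K - j))) ^ 2)) :=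
    mul_nonneg (pow_nonneg (F.scheme_β_nonneg ℰp hγ.le (K - j)) A) (Real.exp_nonneg _)
  exact ae_resDensity_le_envelope_of_anchored F hγ.le K _ hw (hstep K j hj1 hjK hjm a) (hlow K) M hM

end Summit.QuantumFields.YangMills.Theorems.UV3PinnedStepV3OfAnchored

end
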